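import Summits.Ventures.HSemireg.WedgeWeilDegRank
import HarnessLib

/-!
# Venture HSemireg — the IDENTIFIED n = 4 COLUMNS behind the g = 8 census's «necessary numbers», as kernel corollaries of
# THEOREM R (tree files `WedgeWeilRank.lean` ∕ `WedgeWeilDegRank.lean`): HT¹ 16 · HT² 56 + 16ρ · HT³ 112 + 48ρ₃ on Λ•(16 generators)

HONEST FRAMING. Part of the Lean index of the computation cell `pub-hsemireg` (Sunday typer seat p9, § g = 8; companion of
`CensusG8Table.lean` ∕ `CensusG8Verdict.lean`). Finite-dimensional exterior algebra over a field ONLY — the sign-free wedge model of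
the FORMULA-N enclosure (th-7 ∕ th-6 ∕ p3): no variety, no cohomology theory, no semiregularity map is constructed here; nothing here
says that HC ∕ HC_CM ∕ HC_AV holds; no Literature fact is declared or used. The DICTIONARY «rank of θ ↦ θ ∧ v on Λ^m of 2N generators
= rank of the contraction ⌟v on HT^m(A₀) of a Weil-type abelian 2n-fold at a CM anchor, v = f(h) + a w₊ + b w₋ a class-exact
W-carrying class with h-part of Hankel rank ρ» is the cell's (theory/FORMULA-N-th7.md PART B §A.3 ∕ §N; STRUCTURE.md v1.0 §1 D9 ∕
C3 ∕ C4) and is NOT asserted in Lean.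

WHAT THIS FILE RECORDS. The g = 8 census (`target-g8/CENSUS.md` v1.273 `8eb43b237c4e60ad`, §0 «NECESSARY NUMBERS at n = 4», gs-eng-1
THEOREM R + th-6 THEOREM H ∕ COROLLARY R, ×2 derivations + ×2 codes, measured ×5 bench lanes) prints, for every class-exact
W-CARRYING class v on a (4, K, a) member with ρ := Hankel rank of the ℚ[h]-part: rank(⌟v on HT¹) = 4n = 16; rank(⌟v on HT²) =
R₄(v) = (4 + ρ)n² − 2n = 56 ∕ 72 ∕ 88 ∕ 104 (ρ = 0 ∕ 1 ∕ 2 ∕ 3), kernel (4 − ρ)n² = 64 ∕ 48 ∕ 32 ∕ 16 inside dim HT² = C(16,2) = 120;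
on HT³: W alone 112, line bundle + W 160, secant + W 208, generic 304 (ρ₃ = 0, 1, 2, 4). These are the calibration numbers the census's K-rows
reproduce (K21-2 ∕ K22-4 ∕ K20-1 «(120, 88, 32)», D21-1 «rank ⌟(κ ⊠ κ^∨) on HT²(A₀) = 88, ker 32 ×4») and the budget every
SEMIREG+CLASS claim at n = 4 would have to meet («dim Ext²(E,E) ≥ R₄(v(E))», squeeze ⟺ equality). Below they are COROLLARIES AT
n = 4 of the tree's all-n theorems `Wedge.Weil.weilRank_nn` (degree 2, n ≥ 3) and `Wedge.Weil.weilRank_nn_deg` (degree m,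
1 ≤ m < n) — kernel statements about `Module.finrank` of the range of `θ ↦ θ ∧ vW` on `⋀^m (Fin 16 → K)`, for EVERY field K, every
coefficient sequence q (ρ_m = rank of the Hankel matrix `hankel1 K 8 m q`) and all a, b ≠ 0. Arithmetic only; no new mathematics.
-/

namespace Summit.Ventures.HSemireg.CensusG8

open Summit.Ventures.HSemireg.Wedge Summit.Ventures.HSemireg.Wedge.Hankel Summit.Ventures.HSemireg.Wedge.Weil

variable (K : Type*) [Field K]

/-- **Column HT² at n = 4 (STRUCTURE D9 ∕ census §0 R₄):** `rank(θ ↦ θ ∧ v on Λ²) = 56 + 16·ρ` for `v = f + a w₊ + b w₋` on 16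
generators in signature (4,4), `ab ≠ 0`, ρ = rank H₂(q) — i.e. 56 ∕ 72 ∕ 88 ∕ 104 for ρ = 0 ∕ 1 ∕ 2 ∕ 3. Instance n = 4 of
`Wedge.Weil.weilRank_nn`. [bookkeeping; corollary of a tree theorem] -/
theorem rank_HT2_g8 (q : ℕ → K) {a b : K} (ha : a ≠ 0) (hb : b ≠ 0) :
    Module.finrank K (LinearMap.range (wedge K (4 + 4) 2 (vW K (4 + 4) 4 q a b))) =
      56 + 16 * (hankel1 K (4 + 4) 2 q).rank := by
  have h := weilRank_nn K (n := 4) (by norm_num) q ha hb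
  omega

/-- The ambient dimension of that column: `dim Λ²(16 generators) = C(16,2) = 120` (census K-rows «HT² 120»), from the tree's
`Wedge.Weil.finrank_Hom_univ_two`. [bookkeeping; corollary of a tree theorem] -/
theorem dim_HT2_g8 : Module.finrank K ↥(Hom K (In (4 + 4)) Finset.univ 2) = 120 := by
  rw [finrank_Hom_univ_two]; decide

/-- **The secant column (ρ = 2): rank 88, kernel 32 in 120** — the census's «(120, 88, 32)» (K21-2, K22-4, K20-1, B19-1, D21-1):
if the Hankel matrix H₂(q) has rank 2 then the wedge map on Λ² has rank 88 (and 120 − 88 = 32). [bookkeeping; corollary of a tree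
theorem] -/
theorem rank_HT2_g8_secant (q : ℕ → K) {a b : K} (ha : a ≠ 0) (hb : b ≠ 0) (hρ : (hankel1 K (4 + 4) 2 q).rank = 2) :
    Module.finrank K (LinearMap.range (wedge K (4 + 4) 2 (vW K (4 + 4) 4 q a b))) = 88 ∧ 120 - 88 = 32 := by
  refine ⟨?_, rfl⟩
  rw [rank_HT2_g8 K q ha hb, hρ]

/-- The four values of the HT² column at n = 4 as ρ runs through the possible Hankel ranks 0…3 of a 3 × 7 catalecticant:
56 ∕ 72 ∕ 88 ∕ 104, kernels 64 ∕ 48 ∕ 32 ∕ 16. [bookkeeping; arithmetic] -/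
theorem column_HT2_values : (List.range 4).map (fun ρ => (56 + 16 * ρ, 120 - (56 + 16 * ρ))) =
    [(56, 64), (72, 48), (88, 32), (104, 16)] := by decide

/-- **Column HT¹ at n = 4:** `rank(θ ↦ θ ∧ v on Λ¹) = 16 = 4n`, whatever the h-part (census §0 «rank on HT¹ = 4n = 16»; K-rows
«HT¹ (16, 16, 0)»). Instance n = 4, m = 1 of `Wedge.Weil.weilRank_nn_deg`. [bookkeeping; corollary of a tree theorem] -/
theorem rank_HT1_g8 (q : ℕ → K) {a b : K} (ha : a ≠ 0) (hb : b ≠ 0) :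
    Module.finrank K (LinearMap.range (wedge K (4 + 4) 1 (vW K (4 + 4) 4 q a b))) = 16 := by
  have h := weilRank_nn_deg K (n := 4) (m := 1) (by norm_num) (by norm_num) q ha hb
  norm_num [Nat.choose] at h
  omega

/-- **Column HT³ at n = 4:** `rank(θ ↦ θ ∧ v on Λ³) = 112 + 48·ρ₃`, ρ₃ = rank of the 4 × 6 catalecticant H₃(q) = `hankel1 K 8 3 q`
(0 ≤ ρ₃ ≤ 4): 112 (W alone) ∕ 160 (line bundle + W) ∕ 208 (secant + W) ∕ 256 ∕ 304 (generic h-part + W) — census §0 «HT³: GEN 304,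
SEC 208, LB+W 160, W 112» and K21-2 «(560, 208, 352)». Instance n = 4, m = 3 of `Wedge.Weil.weilRank_nn_deg`. [bookkeeping;
corollary of a tree theorem] -/
theorem rank_HT3_g8 (q : ℕ → K) {a b : K} (ha : a ≠ 0) (hb : b ≠ 0) :
    Module.finrank K (LinearMap.range (wedge K (4 + 4) 3 (vW K (4 + 4) 4 q a b))) =
      112 + 48 * (hankel1 K (4 + 4) 3 q).rank := by
  have h := weilRank_nn_deg K (n := 4) (m := 3) (by norm_num) (by norm_num) q ha hb
  norm_num [Nat.choose] at h
  omega

/-- The five values of the HT³ column (ρ₃ = 0, …, 4) inside dim Λ³ = C(16,3) = 560, with kernels: (112, 448) ∕ (160, 400) ∕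
(208, 352) ∕ (256, 304) ∕ (304, 256) — census K21-2 «HT³ (560, 208, 352)», A18-5 «(560, 112, 448)», §0 «GEN 304».
[bookkeeping; arithmetic] -/
theorem column_HT3_values : (Nat.choose 16 3, (List.range 5).map (fun ρ => (112 + 48 * ρ, 560 - (112 + 48 * ρ)))) =
    (560, [(112, 448), (160, 400), (208, 352), (256, 304), (304, 256)]) := by decide

end Summit.Ventures.HSemireg.CensusG8
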